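import Summits.ValiantsHypothesis.ValiantsHypothesis.Theses.SOSTau
import Summits.ValiantsHypothesis.ValiantsHypothesis.Theorems.LacunarySymmetroidMatrixDescartesVSQLaw
import Summits.ValiantsHypothesis.ValiantsHypothesis.Theorems.KPlusLogSqLawLiftingGeneralExcessNoGo
import Summits.ValiantsHypothesis.ValiantsHypothesis.Theorems.LacunarySymmetroidMatrixDescartesCensusDoorA34IsotropicGauge

/-!
# Bridge: Dutta's SOS-τ conjecture (route `SOSTau`) ⇒ the `m = 2` rows of the `MatrixDescartes` census are LINEAR in `K`

HONEST FRAMING.  Helper file (seat val-v1x-eng-6 g3, cell `val-V1-extremal`, 2026-08-29; `--supports` the crux item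
stmt-ValiantsHypothesis-18050 as a helper, no closure claim).  It connects two routes of the tree that so far did not cite
each other in the kernel:

* route `SOSTau` (crux `Theses.SOSTau.SOSTau`, item stmt-ValiantsHypothesis-18748 = Dutta's SOS-τ conjecture, Dutta2021 Conj. 1 /
  Burgisser2024Completeness Conj. 4.2: `∃ c, ∀ s a g, #{real zeros of Σ_{i<s} a_i g_i²} ≤ c · Σ_i |supp g_i|`; `SOSTau ∧ HutchinsonMagnification
  → ValiantsHypothesis` is the tree theorem `SOSTauAssembly`), and
* route `LacunarySymmetroid` / crux `MatrixDescartes` (stmt-ValiantsHypothesis-18050) with its census currency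
  `PosRootLawAt m K B` (symmetric pencils) and control column `GenPosRootLawAt m K B` (general real pencils).

THE OBSERVATION (folklore algebra): the determinant of a `2 × 2` lacunary pencil `Σ_l X^{d_l} S_l` is a WEIGHTED SUM OF FOUR SPARSE
SQUARES, `ad − bc = ((a+d)/2)² − ((a−d)/2)² − ((b+c)/2)² + ((b−c)/2)²`, each square supported inside `{d_l}` (so support-sum `≤ 4K`);
for SYMMETRIC letters the fourth square vanishes (support-sum `≤ 3K`; cf. `Census.FourSquares.det_pencil_two_eq_three_squares`).
Hence (theorems below):

* `genPosRootLawAt_two_of_sosTau` : `SOSTau → ∃ c, ∀ K, GenPosRootLawAt 2 K (c * K)` — the general `m = 2` control column is `O(K)`;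
* `posRootLawAt_two_of_sosTau`    : `SOSTau → ∃ c, ∀ K, PosRootLawAt 2 K (c * K)` — the symmetric `m = 2` row is `O(K)`
  (with the constant `3c`, `posRootLawAt_two_of_sosTauConst`);
* contrapositives `not_sosTau_of_superlinear_gen/sym`: ANY superlinear lower-bound family in an `m = 2` column refutes SOS-τ; in
  particular `not_sosTau_of_genDescartesSharp`: if general `(2,K)` pencils are Descartes-sharp for every `K` (the cell's conjecture
  «ζ_gen(2,K) = K(K+1)/2 − 1», conjb-3 ROUND-2 §C; kernel at `K ≤ 6`), then `¬ SOSTau`;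
* `threeSquares_instance_of_not_posRootLawAt` : every census row `¬ PosRootLawAt 2 K B` is an explicit SOS-τ INSTANCE with three squares,
  support-sum `≤ 3K` and `≥ B + 1` distinct real zeros (an instrument for the SOSTau disprover's calibration target «beat Chebyshev's
  ratio 4»); with the tree's `VSQ.vsq_law` (`ζ_sym(2,K) ≥ 4K − 7 ∀ K ≥ 4`) this gives `vsq_threeSquares_family`, `vsq_le_of_sosTauConst`,
  `two_le_of_sosTauConst`: no constant `c ≤ 1` works
  (weaker than the tree's Chebyshev calibration `c ≥ 4`, recorded only as the pencil-side calibration of record: ratio `(4K−7)/(3K)`).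

WHAT THIS SAYS (numbers, not adjectives).  The cell's open question «is the m = 2 row linear in K?» (a fortiori «is ζ_sym(2,K) − 4K bounded?»)
(val-V1-extremal EXTREMISERS, eng-6 VSQ-MECHANISM §2) is implied by — and its negation would refute — a published conjecture that
implies `VP ≠ VNP`; the first open case of SOS-τ (three squares, which contains Chattopadhyay's `fg + 1` problem,
KoiranPortierTavenas2015 p. 3) contains the symmetric `m = 2` row, and the four-square case contains the general and the
complex-Hermitian `m = 2` rows (the Hermitian twenty `Census.FourSquares.twenty_le_card_posRoots_four_squares` is an `s = 4`
instance with `Z₊ = 20`, support-sum `≤ 24`).  Nothing here decides SOS-τ, `MatrixDescartes` or `VP ≠ VNP`; for `m ≥ 3` a determinant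
is a form of degree `m`, not a sum of squares, so only the `m = 2` rows are touched.

[folklore] `ad − bc = ((a+d)/2)² − ((a−d)/2)² − ((b+c)/2)² + ((b−c)/2)²`; support of a lacunary sum; `Finset` counting.
-/

-- `Summit.ValiantsHypothesis.ValiantsHypothesis.…` repeats a component by the D-0017 layout
-- (single-conjunct summit), which the `dupNamespace` linter flags; the name is mandated.
set_option linter.dupNamespace false
set_option autoImplicit false

namespace Summit.ValiantsHypothesis.ValiantsHypothesis.Theorems.LacunarySymmetroidMatrixDescartes.SOSTauBridge

open Polynomial Finset
open scoped BigOperators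
open Summit.ValiantsHypothesis.ValiantsHypothesis.Theses.SOSTau (SOSTau)
open Summit.ValiantsHypothesis.ValiantsHypothesis.Theorems.MatrixDescartes.Negative (PosRootLawAt)
open Summit.ValiantsHypothesis.ValiantsHypothesis.Theorems.KPlusLogSqLaw.GeneralExcess (GenPosRootLawAt)

/-! ## Lacunary sums (the support bound `|supp Σ_l c_l X^{d_l}| ≤ K` is the tree's `Census.card_support_borderNomial_le`) -/

/-- Additivity of lacunary sums in the coefficient vector. [folklore] -/
theorem lacunary_add {K : ℕ} (d : Fin K → ℕ) (c c' : Fin K → ℝ) :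
    (∑ l, C (c l + c' l) * (X : ℝ[X]) ^ d l) = (∑ l, C (c l) * X ^ d l) + ∑ l, C (c' l) * X ^ d l := by
  rw [← Finset.sum_add_distrib]
  refine Finset.sum_congr rfl fun l _ => ?_
  rw [map_add, add_mul]

/-- Subtractivity of lacunary sums in the coefficient vector. [folklore] -/
theorem lacunary_sub {K : ℕ} (d : Fin K → ℕ) (c c' : Fin K → ℝ) :
    (∑ l, C (c l - c' l) * (X : ℝ[X]) ^ d l) = (∑ l, C (c l) * X ^ d l) - ∑ l, C (c' l) * X ^ d l := by
  rw [← Finset.sum_sub_distrib]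
  refine Finset.sum_congr rfl fun l _ => ?_
  rw [map_sub, sub_mul]

/-- The `(i,j)` entry of the pencil `Σ_l X^{d_l} • S_l` is the lacunary sum with coefficients `S_l i j`. [folklore] -/
theorem pencil_two_apply {K : ℕ} (d : Fin K → ℕ) (S : Fin K → Matrix (Fin 2) (Fin 2) ℝ) (i j : Fin 2) :
    (∑ l, (X : ℝ[X]) ^ d l • (S l).map C) i j = ∑ l, C (S l i j) * (X : ℝ[X]) ^ d l := by
  rw [Matrix.sum_apply]
  refine Finset.sum_congr rfl fun l _ => ?_
  rw [Matrix.smul_apply, Matrix.map_apply, smul_eq_mul, mul_comm]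

/-! ## The determinant of a `2 × 2` pencil is a weighted sum of four sparse squares -/

/-- `C (1/4) · 4 = 1` in `ℝ[X]`. [folklore] -/
theorem C_quarter_mul_four : (C (1 / 4 : ℝ)) * 4 = (1 : ℝ[X]) := by
  rw [show (4 : ℝ[X]) = C (4 : ℝ) from (map_ofNat C 4).symm, ← map_mul]
  norm_num

/-- **Four squares**: `det (Σ_l X^{d_l} S_l) = Σ_{i<4} w_i · g_i²` with weights `w = (1/4, −1/4, −1/4, 1/4)` and the four
LACUNARY squares `g = (a+d, a−d, b+c, b−c)` built entrywise from the letters (each supported inside `{d_l}`) — i.e.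
`ad − bc = ((a+d)² − (a−d)²)/4 − ((b+c)² − (b−c)²)/4`.  No symmetry is assumed. [folklore] -/
theorem det_pencil_two_eq_sum_four_squares {K : ℕ} (d : Fin K → ℕ) (S : Fin K → Matrix (Fin 2) (Fin 2) ℝ) :
    (∑ l, (X : ℝ[X]) ^ d l • (S l).map C).det =
      ∑ i, C ((![1 / 4, -(1 / 4), -(1 / 4), 1 / 4] : Fin 4 → ℝ) i) *
        (![∑ l, C (S l 0 0 + S l 1 1) * (X : ℝ[X]) ^ d l, ∑ l, C (S l 0 0 - S l 1 1) * (X : ℝ[X]) ^ d l,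
           ∑ l, C (S l 0 1 + S l 1 0) * (X : ℝ[X]) ^ d l, ∑ l, C (S l 0 1 - S l 1 0) * (X : ℝ[X]) ^ d l] : Fin 4 → ℝ[X]) i ^ 2 := by
  rw [Matrix.det_fin_two, pencil_two_apply, pencil_two_apply, pencil_two_apply, pencil_two_apply, Fin.sum_univ_four]
  simp only [Matrix.cons_val_zero, Matrix.cons_val_one, Matrix.cons_val, map_neg]
  rw [lacunary_add d (fun l => S l 0 0) (fun l => S l 1 1), lacunary_sub d (fun l => S l 0 0) (fun l => S l 1 1),
    lacunary_add d (fun l => S l 0 1) (fun l => S l 1 0), lacunary_sub d (fun l => S l 0 1) (fun l => S l 1 0)]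
  linear_combination (-((∑ l, C (S l 0 0) * (X : ℝ[X]) ^ d l) * (∑ l, C (S l 1 1) * (X : ℝ[X]) ^ d l)
    - (∑ l, C (S l 0 1) * (X : ℝ[X]) ^ d l) * (∑ l, C (S l 1 0) * (X : ℝ[X]) ^ d l))) * C_quarter_mul_four

/-- The support-sum of the four squares is `≤ 4K`. [folklore] -/
theorem sum_card_support_four_squares_le {K : ℕ} (d : Fin K → ℕ) (S : Fin K → Matrix (Fin 2) (Fin 2) ℝ) :
    ∑ i, ((![∑ l, C (S l 0 0 + S l 1 1) * (X : ℝ[X]) ^ d l, ∑ l, C (S l 0 0 - S l 1 1) * (X : ℝ[X]) ^ d l,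
           ∑ l, C (S l 0 1 + S l 1 0) * (X : ℝ[X]) ^ d l, ∑ l, C (S l 0 1 - S l 1 0) * (X : ℝ[X]) ^ d l] : Fin 4 → ℝ[X]) i).support.card
      ≤ 4 * K := by
  rw [Fin.sum_univ_four]
  simp only [Matrix.cons_val_zero, Matrix.cons_val_one, Matrix.cons_val]
  have h0 := Census.card_support_borderNomial_le d (fun l => S l 0 0 + S l 1 1)
  have h1 := Census.card_support_borderNomial_le d (fun l => S l 0 0 - S l 1 1)
  have h2 := Census.card_support_borderNomial_le d (fun l => S l 0 1 + S l 1 0)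
  have h3 := Census.card_support_borderNomial_le d (fun l => S l 0 1 - S l 1 0)
  omega

/-- For SYMMETRIC letters the fourth square `b − c` vanishes. [folklore] -/
theorem fourth_square_eq_zero_of_symm {K : ℕ} (d : Fin K → ℕ) (S : Fin K → Matrix (Fin 2) (Fin 2) ℝ)
    (hS : ∀ l, (S l).IsSymm) : (∑ l, C (S l 0 1 - S l 1 0) * (X : ℝ[X]) ^ d l) = 0 := by
  refine Finset.sum_eq_zero fun l _ => ?_
  have h10 : S l 1 0 = S l 0 1 := (hS l).apply 0 1
  simp [h10]

/-- For symmetric letters the support-sum of the four squares is `≤ 3K` (three squares). [folklore] -/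
theorem sum_card_support_four_squares_le_of_symm {K : ℕ} (d : Fin K → ℕ) (S : Fin K → Matrix (Fin 2) (Fin 2) ℝ)
    (hS : ∀ l, (S l).IsSymm) :
    ∑ i, ((![∑ l, C (S l 0 0 + S l 1 1) * (X : ℝ[X]) ^ d l, ∑ l, C (S l 0 0 - S l 1 1) * (X : ℝ[X]) ^ d l,
           ∑ l, C (S l 0 1 + S l 1 0) * (X : ℝ[X]) ^ d l, ∑ l, C (S l 0 1 - S l 1 0) * (X : ℝ[X]) ^ d l] : Fin 4 → ℝ[X]) i).support.card
      ≤ 3 * K := by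
  rw [Fin.sum_univ_four]
  simp only [Matrix.cons_val_zero, Matrix.cons_val_one, Matrix.cons_val]
  rw [fourth_square_eq_zero_of_symm d S hS, support_zero, Finset.card_empty, add_zero]
  have h0 := Census.card_support_borderNomial_le d (fun l => S l 0 0 + S l 1 1)
  have h1 := Census.card_support_borderNomial_le d (fun l => S l 0 0 - S l 1 1)
  have h2 := Census.card_support_borderNomial_le d (fun l => S l 0 1 + S l 1 0)
  omega

/-! ## SOS-τ ⇒ the `m = 2` rows are linear in `K` -/

/-- **SOS-τ with constant `c` bounds the general `m = 2` control column by `4cK`.** [folklore] -/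
theorem genPosRootLawAt_two_of_sosTauConst (c : ℕ)
    (h : ∀ (s : ℕ) (a : Fin s → ℝ) (g : Fin s → ℝ[X]),
      (∑ i, C (a i) * g i ^ 2).roots.toFinset.card ≤ c * ∑ i, (g i).support.card)
    (K : ℕ) : GenPosRootLawAt 2 K (4 * c * K) := by
  intro d S
  rw [det_pencil_two_eq_sum_four_squares]
  refine (Finset.card_filter_le _ _).trans ((h 4 _ _).trans ?_)
  calc c * _ ≤ c * (4 * K) := Nat.mul_le_mul_left c (sum_card_support_four_squares_le d S)
    _ = 4 * c * K := by ring

/-- **SOS-τ with constant `c` bounds the symmetric `m = 2` row by `3cK`.** [folklore] -/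
theorem posRootLawAt_two_of_sosTauConst (c : ℕ)
    (h : ∀ (s : ℕ) (a : Fin s → ℝ) (g : Fin s → ℝ[X]),
      (∑ i, C (a i) * g i ^ 2).roots.toFinset.card ≤ c * ∑ i, (g i).support.card)
    (K : ℕ) : PosRootLawAt 2 K (3 * c * K) := by
  intro d S hS
  rw [det_pencil_two_eq_sum_four_squares]
  refine (Finset.card_filter_le _ _).trans ((h 4 _ _).trans ?_)
  calc c * _ ≤ c * (3 * K) := Nat.mul_le_mul_left c (sum_card_support_four_squares_le_of_symm d S hS)
    _ = 3 * c * K := by ring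

/-- **Dutta's SOS-τ conjecture implies that the general `(2,K)` control column of the census is linear in `K`.** [folklore] -/
theorem genPosRootLawAt_two_of_sosTau (h : SOSTau) : ∃ c : ℕ, ∀ K : ℕ, GenPosRootLawAt 2 K (c * K) := by
  obtain ⟨c, hc⟩ := h
  exact ⟨4 * c, fun K => genPosRootLawAt_two_of_sosTauConst c hc K⟩

/-- **Dutta's SOS-τ conjecture implies that the symmetric `(2,K)` row of the census is linear in `K`** — the cell's question
«is `ζ_sym(2,K)` linear in `K`?» has the answer YES under SOS-τ. [folklore] -/
theorem posRootLawAt_two_of_sosTau (h : SOSTau) : ∃ c : ℕ, ∀ K : ℕ, PosRootLawAt 2 K (c * K) := by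
  obtain ⟨c, hc⟩ := h
  exact ⟨3 * c, fun K => posRootLawAt_two_of_sosTauConst c hc K⟩

/-! ## Contrapositives: superlinear `m = 2` columns refute SOS-τ -/

/-- A superlinear general `m = 2` column refutes SOS-τ. [folklore] -/
theorem not_sosTau_of_superlinear_gen (h : ∀ c : ℕ, ∃ K : ℕ, ¬ GenPosRootLawAt 2 K (c * K)) : ¬ SOSTau := by
  intro hs
  obtain ⟨c, hc⟩ := genPosRootLawAt_two_of_sosTau hs
  obtain ⟨K, hK⟩ := h c
  exact hK (hc K)

/-- A superlinear symmetric `m = 2` row refutes SOS-τ. [folklore] -/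
theorem not_sosTau_of_superlinear_sym (h : ∀ c : ℕ, ∃ K : ℕ, ¬ PosRootLawAt 2 K (c * K)) : ¬ SOSTau := by
  intro hs
  obtain ⟨c, hc⟩ := posRootLawAt_two_of_sosTau hs
  obtain ⟨K, hK⟩ := h c
  exact hK (hc K)

/-- **If general `(2,K)` pencils are Descartes-sharp for every `K ≥ 2` (`ζ_gen(2,K) ≥ K(K+1)/2 − 1`, i.e.
`¬ GenPosRootLawAt 2 K (K(K+1)/2 − 2)`; kernel for `K ≤ 6`, conjectured by the cell for all `K`), then SOS-τ is false.** [folklore] -/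
theorem not_sosTau_of_genDescartesSharp (h : ∀ K : ℕ, 2 ≤ K → ¬ GenPosRootLawAt 2 K (K * (K + 1) / 2 - 2)) : ¬ SOSTau := by
  refine not_sosTau_of_superlinear_gen fun c => ⟨2 * c + 4, fun hlaw => ?_⟩
  refine h (2 * c + 4) (by omega) ?_
  refine fun d S => (hlaw d S).trans ?_
  have h1 : (2 * c + 4) * (2 * c + 4 + 1) / 2 = (c + 2) * (2 * c + 5) := by
    rw [show (2 * c + 4) * (2 * c + 4 + 1) = (c + 2) * (2 * c + 5) * 2 by ring]
    exact Nat.mul_div_cancel _ (by norm_num)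
  rw [h1]
  have h2 : c * (2 * c + 4) + 2 ≤ (c + 2) * (2 * c + 5) := by nlinarith
  omega

/-! ## Census rows as SOS-τ instances (the instrument) and the pencil-side calibration of record -/

/-- **Every symmetric census row is a three-square SOS-τ instance**: `¬ PosRootLawAt 2 K B` yields real weights
`a : Fin 4 → ℝ` and polynomials `g : Fin 4 → ℝ[X]` with `g 3 = 0`, support-sum `≤ 3K` and at least `B + 1` distinct real
zeros of `Σ a_i g_i²`. [folklore] -/
theorem threeSquares_instance_of_not_posRootLawAt {K B : ℕ} (h : ¬ PosRootLawAt 2 K B) :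
    ∃ (a : Fin 4 → ℝ) (g : Fin 4 → ℝ[X]), g 3 = 0 ∧ ∑ i, (g i).support.card ≤ 3 * K ∧
      B + 1 ≤ (∑ i, C (a i) * g i ^ 2).roots.toFinset.card := by
  unfold PosRootLawAt at h
  push Not at h
  obtain ⟨d, S, hS, hB⟩ := h
  refine ⟨(![1 / 4, -(1 / 4), -(1 / 4), 1 / 4] : Fin 4 → ℝ),
    (![∑ l, C (S l 0 0 + S l 1 1) * (X : ℝ[X]) ^ d l, ∑ l, C (S l 0 0 - S l 1 1) * (X : ℝ[X]) ^ d l,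
      ∑ l, C (S l 0 1 + S l 1 0) * (X : ℝ[X]) ^ d l, ∑ l, C (S l 0 1 - S l 1 0) * (X : ℝ[X]) ^ d l] : Fin 4 → ℝ[X]), ?_,
    sum_card_support_four_squares_le_of_symm d S hS, ?_⟩
  · simp only [Matrix.cons_val]
    exact fourth_square_eq_zero_of_symm d S hS
  · rw [← det_pencil_two_eq_sum_four_squares]
    exact (Nat.succ_le_of_lt hB).trans (Finset.card_filter_le _ _)

/-- **Every general census row is a four-square SOS-τ instance** (support-sum `≤ 4K`, `≥ B + 1` distinct real zeros). [folklore] -/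
theorem fourSquares_instance_of_not_genPosRootLawAt {K B : ℕ} (h : ¬ GenPosRootLawAt 2 K B) :
    ∃ (a : Fin 4 → ℝ) (g : Fin 4 → ℝ[X]), ∑ i, (g i).support.card ≤ 4 * K ∧
      B + 1 ≤ (∑ i, C (a i) * g i ^ 2).roots.toFinset.card := by
  unfold GenPosRootLawAt at h
  push Not at h
  obtain ⟨d, S, hB⟩ := h
  refine ⟨(![1 / 4, -(1 / 4), -(1 / 4), 1 / 4] : Fin 4 → ℝ),
    (![∑ l, C (S l 0 0 + S l 1 1) * (X : ℝ[X]) ^ d l, ∑ l, C (S l 0 0 - S l 1 1) * (X : ℝ[X]) ^ d l,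
      ∑ l, C (S l 0 1 + S l 1 0) * (X : ℝ[X]) ^ d l, ∑ l, C (S l 0 1 - S l 1 0) * (X : ℝ[X]) ^ d l] : Fin 4 → ℝ[X]),
    sum_card_support_four_squares_le d S, ?_⟩
  rw [← det_pencil_two_eq_sum_four_squares]
  exact (Nat.succ_le_of_lt hB).trans (Finset.card_filter_le _ _)

/-- **The all-`K` pencil family as SOS-τ instances**: for every `K ≥ 4` there is a three-square instance (the fourth
polynomial zero) with support-sum `≤ 3K` and at least `4K − 7` distinct real zeros — the tree's `VSQ.vsq_law`
(«Viro patchworking + square splitting») read in SOSTau's currency. [folklore] -/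
theorem vsq_threeSquares_family (K : ℕ) (hK : 4 ≤ K) :
    ∃ (a : Fin 4 → ℝ) (g : Fin 4 → ℝ[X]), g 3 = 0 ∧ ∑ i, (g i).support.card ≤ 3 * K ∧
      4 * K - 7 ≤ (∑ i, C (a i) * g i ^ 2).roots.toFinset.card := by
  obtain ⟨a, g, h3, hs, hz⟩ := threeSquares_instance_of_not_posRootLawAt (VSQ.vsq_law K hK)
  exact ⟨a, g, h3, hs, by omega⟩

/-- **Pencil-side calibration of record**: an SOS-τ constant `c` must satisfy `4K − 7 ≤ 3cK` for every `K ≥ 4`; in particular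
`c ≥ 2` (take `K = 8`).  Weaker than the tree's Chebyshev calibration (`c ≥ 4`, `SOSTau.chebyshevCalibration_proof`); recorded as
the ratio of record `(4K−7)/(3K)` for lacunary symmetric pencils (with doubled exponents `(8K−14)/(3K) → 8/3`). [folklore] -/
theorem vsq_le_of_sosTauConst (c : ℕ)
    (h : ∀ (s : ℕ) (a : Fin s → ℝ) (g : Fin s → ℝ[X]),
      (∑ i, C (a i) * g i ^ 2).roots.toFinset.card ≤ c * ∑ i, (g i).support.card)
    (K : ℕ) (hK : 4 ≤ K) : 4 * K - 7 ≤ 3 * c * K := by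
  by_contra hlt
  push Not at hlt
  have hlaw : PosRootLawAt 2 K (3 * c * K) := posRootLawAt_two_of_sosTauConst c h K
  have hmono : PosRootLawAt 2 K (4 * K - 8) := fun d S hS => (hlaw d S hS).trans (by omega)
  exact VSQ.vsq_law K hK hmono

/-- Corollary: no SOS-τ constant `c ≤ 1` is compatible with the symmetric `m = 2` row. [folklore] -/
theorem two_le_of_sosTauConst (c : ℕ)
    (h : ∀ (s : ℕ) (a : Fin s → ℝ) (g : Fin s → ℝ[X]),
      (∑ i, C (a i) * g i ^ 2).roots.toFinset.card ≤ c * ∑ i, (g i).support.card) : 2 ≤ c := by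
  have h8 := vsq_le_of_sosTauConst c h 8 (by norm_num)
  omega

end Summit.ValiantsHypothesis.ValiantsHypothesis.Theorems.LacunarySymmetroidMatrixDescartes.SOSTauBridge
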